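import Mathlib
import Summits.Schanuel.Schanuel.Theses.RigidCore

/-!
# Stub `stub_sweepToSubspace_of_line` (crux stmt-Schanuel-0969, line kernel-arithmetic-selection)

`x` a first failure of rank `n ≥ 3` (ℚ-linearly independent, `trdeg ℚ(x, eˣ) < n`, Schanuel in
ranks `< n`), `y = eˣ`, `P_x = ker (aeval (x, y)) ⊆ ℚ[X, Y]`, `W_y = {z | p(z, y) = 0 ∀ p ∈ P_x}` the
fibre of the ℚ-locus, `D = {k ∈ ℤⁿ | x + 2πik is a mate}`.  The registered stub asks, for `D`
infinite, for a rational-direction affine subspace of codimension `m < n` through a mate-translate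
inside `W_y`, GIVEN the hard case as a hypothesis: "if `2πi` is algebraic over `ℚ(x, eˣ)` and no
rational line `k₀ + ℤv` through a mate `k₀ ∈ D` carries infinitely many mates, then some complex
line `x + 2πik₀ + ℂv` (`k₀ ∈ D`, `v ∈ ℤⁿ ∖ 0`) lies in `W_y`" (that case is the separate stubs
`stub_sweepLine_algPeriod` / `stub_sweepLine_hardCore`, not touched here).
Proved here (sorry-free):
* `aeval_line_eq_zero_of_infinite` — a line meeting `W_y` in infinitely many points lies in it;
* `concl_of_line` — LINE ⟹ CONCLUSION: a rational line through a mate-translate inside `W_y` ⟹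
  the registered conclusion with `m = n - 1` and the forms `q_j = v_{i₀} e_j - v_j e_{i₀}`;
* `concl_of_collinear` — COLLINEAR CASE: infinitely many `k ∈ D` on one rational line ⟹ conclusion;
* `inW_line_of_transcendental`, `concl_of_transcendental` — CASE A: `2πi` transcendental over
  `ℚ(x, eˣ)` ⟹ for `k ∈ D` the whole line `x + ℂ·k` lies in `W_y` ⟹ conclusion;
* `stub_sweepToSubspace_of_line` — the registered signature: Case A, else the collinear case, else
  the hypothesis delivers a line and `concl_of_line` finishes.
-/

noncomputable section

set_option linter.dupNamespace false

open Complex Set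

namespace Summit.Schanuel.Schanuel.Cruxes.MinimalCounterexampleInAcl.KernelArithmeticSelection

open Literature.NumberTheory.Transcendental (SchanuelRank)

variable {n : ℕ}

/-- `e^{x + 2πik} = eˣ` coordinatewise. -/
theorem cexp_kerTranslate (x : Fin n → ℂ) (k : Fin n → ℤ) :
    (Complex.exp ∘ fun i => x i + 2 * ↑Real.pi * Complex.I * (k i : ℂ)) = Complex.exp ∘ x := by
  funext i
  have h : Complex.exp (2 * ↑Real.pi * I * (k i : ℂ)) = 1 := by
    rw [← Complex.exp_int_mul_two_pi_mul_I (k i)]; congr 1; ring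
  simp only [Function.comp_apply, Complex.exp_add, h, mul_one]

/-! ### Lines in the fibre `W_y` -/

/-- Restriction of a `ℚ`-polynomial in `(X, Y)` to the parametrised line `s ↦ (a + s·v, y)` is the
evaluation at `s` of a univariate polynomial over `ℂ`. -/
theorem aeval_line_eq (a v y : Fin n → ℂ) (p : MvPolynomial (Fin n ⊕ Fin n) ℚ) (s : ℂ) :
    MvPolynomial.aeval (Sum.elim (fun i => a i + s * v i) y) p =
      Polynomial.eval s (MvPolynomial.aeval
        (Sum.elim (fun i => Polynomial.C (a i) + Polynomial.C (v i) * Polynomial.X)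
          (fun i => Polynomial.C (y i))) p) := by
  set L : MvPolynomial (Fin n ⊕ Fin n) ℚ →ₐ[ℚ] Polynomial ℂ := MvPolynomial.aeval
    (Sum.elim (fun i => Polynomial.C (a i) + Polynomial.C (v i) * Polynomial.X)
      (fun i => Polynomial.C (y i))) with hL
  have h : (MvPolynomial.aeval (Sum.elim (fun i => a i + s * v i) y) :
      MvPolynomial (Fin n ⊕ Fin n) ℚ →ₐ[ℚ] ℂ) =
      ((Polynomial.aeval s : Polynomial ℂ →ₐ[ℂ] ℂ).restrictScalars ℚ).comp L := by
    refine MvPolynomial.algHom_ext fun j => ?_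
    rcases j with i | i
    · simp [hL]
      ring
    · simp [hL]
  have := congrArg (fun φ : MvPolynomial (Fin n ⊕ Fin n) ℚ →ₐ[ℚ] ℂ => φ p) h
  simpa [Polynomial.coe_aeval_eq_eval] using this

/-- A line meeting the zero set of `p( · , y)` in infinitely many points lies in it. -/
theorem aeval_line_eq_zero_of_infinite (a v y : Fin n → ℂ) (p : MvPolynomial (Fin n ⊕ Fin n) ℚ)
    (hinf : {s : ℂ | MvPolynomial.aeval (Sum.elim (fun i => a i + s * v i) y) p = 0}.Infinite)
    (s : ℂ) : MvPolynomial.aeval (Sum.elim (fun i => a i + s * v i) y) p = 0 := by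
  have h0 : MvPolynomial.aeval
      (Sum.elim (fun i => Polynomial.C (a i) + Polynomial.C (v i) * Polynomial.X)
        (fun i => Polynomial.C (y i))) p = 0 := by
    refine Polynomial.eq_zero_of_infinite_isRoot _ (Set.Infinite.mono (fun t ht => ?_) hinf)
    simpa only [Set.mem_setOf_eq, aeval_line_eq, Polynomial.IsRoot.def] using ht
  rw [aeval_line_eq, h0, Polynomial.eval_zero]

/-- **Line ⟹ registered conclusion.** If the complex line through the mate-translate
`x* = x + 2πik₀` in the rational direction `v ≠ 0` lies in the fibre `W_y`, then the registered
conclusion of the stub holds with `m = n - 1` and the `n - 1` rational forms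
`q_j = v_{i₀} e_j - v_j e_{i₀}` (`j ≠ i₀`, `v_{i₀} ≠ 0`), which cut out exactly that line. -/
theorem concl_of_line (x : Fin n → ℂ) (k₀ v : Fin n → ℤ) (hv : v ≠ 0)
    (hk₀ : LinearIndependent ℚ (fun i => x i + 2 * ↑Real.pi * Complex.I * (k₀ i : ℂ)) ∧
      ∀ p : MvPolynomial (Fin n ⊕ Fin n) ℚ,
        MvPolynomial.aeval (Sum.elim x (Complex.exp ∘ x)) p = 0 →
        MvPolynomial.aeval (Sum.elim (fun i => x i + 2 * ↑Real.pi * Complex.I * (k₀ i : ℂ))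
          (Complex.exp ∘ fun i => x i + 2 * ↑Real.pi * Complex.I * (k₀ i : ℂ))) p = 0)
    (hline : ∀ s : ℂ, ∀ p : MvPolynomial (Fin n ⊕ Fin n) ℚ,
      MvPolynomial.aeval (Sum.elim x (Complex.exp ∘ x)) p = 0 →
      MvPolynomial.aeval (Sum.elim
        (fun i => x i + 2 * ↑Real.pi * Complex.I * (k₀ i : ℂ) + s * (v i : ℂ))
        (Complex.exp ∘ x)) p = 0) :
    ∃ (m : ℕ) (q : Fin m → Fin n → ℚ) (k₀ : Fin n → ℤ), m < n ∧ LinearIndependent ℚ q ∧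
      (LinearIndependent ℚ (fun i => x i + 2 * ↑Real.pi * Complex.I * (k₀ i : ℂ)) ∧
        ∀ p : MvPolynomial (Fin n ⊕ Fin n) ℚ,
          MvPolynomial.aeval (Sum.elim x (Complex.exp ∘ x)) p = 0 →
          MvPolynomial.aeval (Sum.elim (fun i => x i + 2 * ↑Real.pi * Complex.I * (k₀ i : ℂ))
            (Complex.exp ∘ fun i => x i + 2 * ↑Real.pi * Complex.I * (k₀ i : ℂ))) p = 0) ∧
      ∀ z : Fin n → ℂ, (∀ j, ∑ i, (q j i : ℂ) * z i =
          ∑ i, (q j i : ℂ) * (x i + 2 * ↑Real.pi * Complex.I * (k₀ i : ℂ))) →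
        ∀ p : MvPolynomial (Fin n ⊕ Fin n) ℚ,
          MvPolynomial.aeval (Sum.elim x (Complex.exp ∘ x)) p = 0 →
          MvPolynomial.aeval (Sum.elim z (Complex.exp ∘ x)) p = 0 := by
  classical
  obtain ⟨i₀, hi₀⟩ : ∃ i₀, v i₀ ≠ 0 := not_forall.1 fun h => hv (funext h)
  cases n with
  | zero => exact i₀.elim0
  | succ n' =>
    set xs : Fin (n' + 1) → ℂ := fun i => x i + 2 * ↑Real.pi * Complex.I * (k₀ i : ℂ) with hxs
    -- the `n'` rational forms `v_{i₀} e_{σ j} - v_{σ j} e_{i₀}`, `σ = i₀.succAbove`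
    let q : Fin n' → Fin (n' + 1) → ℚ := fun j i =>
      (v i₀ : ℚ) * (if i = i₀.succAbove j then 1 else 0) -
        (v (i₀.succAbove j) : ℚ) * (if i = i₀ then 1 else 0)
    have hqC : ∀ j i, (q j i : ℂ) = (v i₀ : ℂ) * (if i = i₀.succAbove j then 1 else 0) -
        (v (i₀.succAbove j) : ℂ) * (if i = i₀ then 1 else 0) := by
      intro j i
      simp only [q]
      split_ifs <;> push_cast <;> ring
    have hsum : ∀ (w : Fin (n' + 1) → ℂ) (j : Fin n'), ∑ i, (q j i : ℂ) * w i =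
        (v i₀ : ℂ) * w (i₀.succAbove j) - (v (i₀.succAbove j) : ℂ) * w i₀ := by
      intro w j
      simp only [hqC, sub_mul, Finset.sum_sub_distrib, mul_assoc, ite_mul, one_mul, zero_mul,
        mul_ite, mul_zero, Finset.sum_ite_eq', Finset.mem_univ, if_true]
    have hq1 : ∀ j j', q j (i₀.succAbove j') = if j' = j then (v i₀ : ℚ) else 0 := by
      intro j j'
      simp only [q, Fin.succAbove_right_inj, Fin.succAbove_ne, if_false, mul_zero, sub_zero,
        mul_ite, mul_one]
    refine ⟨n', q, k₀, Nat.lt_succ_self n', ?_, hk₀, ?_⟩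
    · -- linear independence of the forms: read off the `succAbove j`-th coordinates
      rw [Fintype.linearIndependent_iff]
      intro g hg j
      have h := congrFun hg (i₀.succAbove j)
      rw [Finset.sum_apply] at h
      simp only [Pi.smul_apply, smul_eq_mul, hq1, mul_ite, mul_zero, Finset.sum_ite_eq,
        Finset.mem_univ, if_true, Pi.zero_apply] at h
      have hv0 : (v i₀ : ℚ) ≠ 0 := by exact_mod_cast hi₀
      exact (mul_eq_zero.1 h).resolve_right hv0
    · intro z hz p hp
      have hvC : (v i₀ : ℂ) ≠ 0 := by exact_mod_cast hi₀
      set s : ℂ := (z i₀ - xs i₀) / (v i₀ : ℂ) with hs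
      have hz' : ∀ j, (v i₀ : ℂ) * z (i₀.succAbove j) - (v (i₀.succAbove j) : ℂ) * z i₀ =
          (v i₀ : ℂ) * xs (i₀.succAbove j) - (v (i₀.succAbove j) : ℂ) * xs i₀ := by
        intro j
        have := hz j
        rwa [hsum, hsum] at this
      have hzeq : z = fun i => xs i + s * (v i : ℂ) := by
        funext i
        rcases Fin.eq_self_or_eq_succAbove i₀ i with h | ⟨j, h⟩
        · rw [h, hs, div_mul_cancel₀ _ hvC]
          ring
        · rw [h]
          have key : (v i₀ : ℂ) * (z (i₀.succAbove j) -
              (xs (i₀.succAbove j) + s * (v (i₀.succAbove j) : ℂ))) =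
              ((v i₀ : ℂ) * z (i₀.succAbove j) - (v (i₀.succAbove j) : ℂ) * z i₀) -
                ((v i₀ : ℂ) * xs (i₀.succAbove j) - (v (i₀.succAbove j) : ℂ) * xs i₀) := by
            rw [hs]
            field_simp
            ring
          rw [hz' j, sub_self] at key
          exact sub_eq_zero.1 ((mul_eq_zero.1 key).resolve_left hvC)
      rw [hzeq]
      exact hline s p hp

/-- **Collinear case.** If infinitely many `k ∈ D` lie on one rational line `k₀ + ℤ·v` (`k₀ ∈ D`,
`v ≠ 0`), the registered conclusion holds: the complex line `x + 2πik₀ + ℂ·v` meets `W_y` in the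
infinitely many points `x + 2πi(k₀ + t v)` and therefore lies in `W_y`. -/
theorem concl_of_collinear (x : Fin n → ℂ) (k₀ v : Fin n → ℤ) (hv : v ≠ 0)
    (hk₀ : LinearIndependent ℚ (fun i => x i + 2 * ↑Real.pi * Complex.I * (k₀ i : ℂ)) ∧
      ∀ p : MvPolynomial (Fin n ⊕ Fin n) ℚ,
        MvPolynomial.aeval (Sum.elim x (Complex.exp ∘ x)) p = 0 →
        MvPolynomial.aeval (Sum.elim (fun i => x i + 2 * ↑Real.pi * Complex.I * (k₀ i : ℂ))
          (Complex.exp ∘ fun i => x i + 2 * ↑Real.pi * Complex.I * (k₀ i : ℂ))) p = 0)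
    (hinf : {t : ℤ | ∀ p : MvPolynomial (Fin n ⊕ Fin n) ℚ,
        MvPolynomial.aeval (Sum.elim x (Complex.exp ∘ x)) p = 0 →
        MvPolynomial.aeval (Sum.elim (fun i => x i + 2 * ↑Real.pi * Complex.I * ((k₀ + t • v) i : ℂ))
          (Complex.exp ∘ fun i => x i + 2 * ↑Real.pi * Complex.I * ((k₀ + t • v) i : ℂ))) p = 0}.Infinite) :
    ∃ (m : ℕ) (q : Fin m → Fin n → ℚ) (k₀ : Fin n → ℤ), m < n ∧ LinearIndependent ℚ q ∧
      (LinearIndependent ℚ (fun i => x i + 2 * ↑Real.pi * Complex.I * (k₀ i : ℂ)) ∧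
        ∀ p : MvPolynomial (Fin n ⊕ Fin n) ℚ,
          MvPolynomial.aeval (Sum.elim x (Complex.exp ∘ x)) p = 0 →
          MvPolynomial.aeval (Sum.elim (fun i => x i + 2 * ↑Real.pi * Complex.I * (k₀ i : ℂ))
            (Complex.exp ∘ fun i => x i + 2 * ↑Real.pi * Complex.I * (k₀ i : ℂ))) p = 0) ∧
      ∀ z : Fin n → ℂ, (∀ j, ∑ i, (q j i : ℂ) * z i =
          ∑ i, (q j i : ℂ) * (x i + 2 * ↑Real.pi * Complex.I * (k₀ i : ℂ))) →
        ∀ p : MvPolynomial (Fin n ⊕ Fin n) ℚ,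
          MvPolynomial.aeval (Sum.elim x (Complex.exp ∘ x)) p = 0 →
          MvPolynomial.aeval (Sum.elim z (Complex.exp ∘ x)) p = 0 := by
  refine concl_of_line x k₀ v hv hk₀ fun s p hp => ?_
  apply aeval_line_eq_zero_of_infinite
    (fun i => x i + 2 * ↑Real.pi * Complex.I * (k₀ i : ℂ)) (fun i => (v i : ℂ)) (Complex.exp ∘ x) p
  have h2πi : (2 * ↑Real.pi * Complex.I : ℂ) ≠ 0 := by
    simp [Real.pi_ne_zero, Complex.I_ne_zero]
  have hinj : Set.InjOn (fun t : ℤ => 2 * ↑Real.pi * Complex.I * (t : ℂ)) Set.univ := by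
    intro t _ t' _ h
    have := mul_left_cancel₀ h2πi h
    exact_mod_cast this
  refine Set.Infinite.mono ?_ ((Set.infinite_image_iff (hinj.mono (Set.subset_univ _))).2 hinf)
  rintro _ ⟨t, ht, rfl⟩
  have := ht p hp
  rw [cexp_kerTranslate] at this
  have hfun : (fun i => x i + 2 * ↑Real.pi * Complex.I * (k₀ i : ℂ) +
      2 * ↑Real.pi * Complex.I * (t : ℂ) * (v i : ℂ)) =
      (fun i => x i + 2 * ↑Real.pi * Complex.I * ((k₀ + t • v) i : ℂ)) := by
    funext i
    simp only [Pi.add_apply, Pi.smul_apply, smul_eq_mul, Int.cast_add, Int.cast_mul]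
    ring
  exact (congrArg (fun f : Fin n → ℂ =>
    MvPolynomial.aeval (Sum.elim f (Complex.exp ∘ x)) p = 0) hfun).mpr this

/-- **Case A: the restriction to a line through `x` in a direction `k ∈ D` vanishes identically when
`2πi` is transcendental over `ℚ(x, eˣ)`.** For `p ∈ P_x`, `s ↦ p(x + s k, eˣ)` is a polynomial with
coefficients in `K = ℚ(x, eˣ)` vanishing at `s = 2πi`; so it is the zero polynomial. -/
theorem inW_line_of_transcendental (x : Fin n → ℂ) (k : Fin n → ℤ)
    (hk : ∀ p : MvPolynomial (Fin n ⊕ Fin n) ℚ,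
        MvPolynomial.aeval (Sum.elim x (Complex.exp ∘ x)) p = 0 →
        MvPolynomial.aeval (Sum.elim (fun i => x i + 2 * ↑Real.pi * Complex.I * (k i : ℂ))
          (Complex.exp ∘ fun i => x i + 2 * ↑Real.pi * Complex.I * (k i : ℂ))) p = 0)
    (hπ : Transcendental ↥(IntermediateField.adjoin ℚ (Set.range x ∪ Set.range (Complex.exp ∘ x)))
      (2 * ↑Real.pi * Complex.I)) (s : ℂ) :
    ∀ p : MvPolynomial (Fin n ⊕ Fin n) ℚ,
      MvPolynomial.aeval (Sum.elim x (Complex.exp ∘ x)) p = 0 →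
      MvPolynomial.aeval (Sum.elim (fun i => x i + s * (k i : ℂ)) (Complex.exp ∘ x)) p = 0 := by
  intro p hp
  set K := IntermediateField.adjoin ℚ (Set.range x ∪ Set.range (Complex.exp ∘ x)) with hK
  have hxK : ∀ i, x i ∈ K := fun i =>
    IntermediateField.subset_adjoin ℚ _ (Or.inl (Set.mem_range_self i))
  have hyK : ∀ i, Complex.exp (x i) ∈ K := fun i =>
    IntermediateField.subset_adjoin ℚ _ (Or.inr ⟨i, rfl⟩)
  have hkK : ∀ i, ((k i : ℂ)) ∈ K := fun i => intCast_mem K (k i)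
  -- the restriction of `p` to the line, a polynomial over `K`
  set L : MvPolynomial (Fin n ⊕ Fin n) ℚ →ₐ[ℚ] Polynomial K := MvPolynomial.aeval
    (Sum.elim (fun i => Polynomial.C (⟨x i, hxK i⟩ : K) + Polynomial.C (⟨(k i : ℂ), hkK i⟩ : K) *
      Polynomial.X) (fun i => Polynomial.C (⟨Complex.exp (x i), hyK i⟩ : K))) with hL
  have hev : ∀ t : ℂ, (MvPolynomial.aeval (Sum.elim (fun i => x i + t * (k i : ℂ)) (Complex.exp ∘ x)) :
      MvPolynomial (Fin n ⊕ Fin n) ℚ →ₐ[ℚ] ℂ) =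
      ((Polynomial.aeval t : Polynomial K →ₐ[K] ℂ).restrictScalars ℚ).comp L := by
    intro t
    refine MvPolynomial.algHom_ext fun j => ?_
    rcases j with i | i
    · simp [hL]
      ring
    · simp [hL]
  have hev' : ∀ t : ℂ, MvPolynomial.aeval (Sum.elim (fun i => x i + t * (k i : ℂ)) (Complex.exp ∘ x)) p
      = Polynomial.aeval t (L p) := fun t =>
    congrArg (fun φ : MvPolynomial (Fin n ⊕ Fin n) ℚ →ₐ[ℚ] ℂ => φ p) (hev t)
  -- it vanishes at `2πi`
  have hroot : Polynomial.aeval (2 * ↑Real.pi * Complex.I) (L p) = 0 := by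
    rw [← hev']
    have := hk p hp
    rwa [cexp_kerTranslate] at this
  have hL0 : L p = 0 := by_contra fun hne => hπ ⟨L p, hne, hroot⟩  -- hence it is zero
  rw [hev', hL0, map_zero]

/-- **Case A ⟹ registered conclusion**: if `2πi` is transcendental over `ℚ(x, eˣ)` and `D` is
infinite, pick `k₀ ∈ D ∖ {0}`; the line `x + ℂ·k₀ = (x + 2πik₀) + ℂ·k₀` lies in `W_y`. -/
theorem concl_of_transcendental (x : Fin n → ℂ)
    (hD : {k : Fin n → ℤ | LinearIndependent ℚ (fun i => x i + 2 * ↑Real.pi * Complex.I * (k i : ℂ)) ∧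
      ∀ p : MvPolynomial (Fin n ⊕ Fin n) ℚ,
        MvPolynomial.aeval (Sum.elim x (Complex.exp ∘ x)) p = 0 →
        MvPolynomial.aeval (Sum.elim (fun i => x i + 2 * ↑Real.pi * Complex.I * (k i : ℂ))
          (Complex.exp ∘ fun i => x i + 2 * ↑Real.pi * Complex.I * (k i : ℂ))) p = 0}.Infinite)
    (hπ : Transcendental ↥(IntermediateField.adjoin ℚ (Set.range x ∪ Set.range (Complex.exp ∘ x)))
      (2 * ↑Real.pi * Complex.I)) :
    ∃ (m : ℕ) (q : Fin m → Fin n → ℚ) (k₀ : Fin n → ℤ), m < n ∧ LinearIndependent ℚ q ∧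
      (LinearIndependent ℚ (fun i => x i + 2 * ↑Real.pi * Complex.I * (k₀ i : ℂ)) ∧
        ∀ p : MvPolynomial (Fin n ⊕ Fin n) ℚ,
          MvPolynomial.aeval (Sum.elim x (Complex.exp ∘ x)) p = 0 →
          MvPolynomial.aeval (Sum.elim (fun i => x i + 2 * ↑Real.pi * Complex.I * (k₀ i : ℂ))
            (Complex.exp ∘ fun i => x i + 2 * ↑Real.pi * Complex.I * (k₀ i : ℂ))) p = 0) ∧
      ∀ z : Fin n → ℂ, (∀ j, ∑ i, (q j i : ℂ) * z i =
          ∑ i, (q j i : ℂ) * (x i + 2 * ↑Real.pi * Complex.I * (k₀ i : ℂ))) →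
        ∀ p : MvPolynomial (Fin n ⊕ Fin n) ℚ,
          MvPolynomial.aeval (Sum.elim x (Complex.exp ∘ x)) p = 0 →
          MvPolynomial.aeval (Sum.elim z (Complex.exp ∘ x)) p = 0 := by
  obtain ⟨k₀, hk₀, hk₀0⟩ := hD.nontrivial.exists_ne 0
  refine concl_of_line x k₀ k₀ hk₀0 hk₀ fun s p hp => ?_
  have := inW_line_of_transcendental x k₀ hk₀.2 hπ (2 * ↑Real.pi * Complex.I + s) p hp
  have hfun : (fun i => x i + 2 * ↑Real.pi * Complex.I * (k₀ i : ℂ) + s * (k₀ i : ℂ)) =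
      (fun i => x i + (2 * ↑Real.pi * Complex.I + s) * (k₀ i : ℂ)) := by
    funext i
    ring
  exact (congrArg (fun f : Fin n → ℂ =>
    MvPolynomial.aeval (Sum.elim f (Complex.exp ∘ x)) p = 0) hfun).mpr this

/-! ### The registered statement -/

/-- **Stub `stub_sweepToSubspace_of_line`.** For a first failure `x` of rank `n ≥ 3` with
infinitely many mates `x + 2πik`, the registered conclusion of the sweep (a rational-direction
affine subspace of codimension `m < n` through a mate-translate inside the fibre `W_y`) holds,
provided the hard case (`2πi` algebraic over `ℚ(x, eˣ)`, every rational line through a mate meeting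
`D` finitely) delivers a complex line `x + 2πik₀ + ℂv ⊆ W_y`.  Proof: Case A
(`concl_of_transcendental`), else the collinear case (`concl_of_collinear`), else the hypothesis
and `concl_of_line`. -/
theorem stub_sweepToSubspace_of_line : ∀ (n : ℕ), 3 ≤ n → ∀ (x : Fin n → ℂ), (LinearIndependent ℚ x ∧ Algebra.trdeg ℚ ↥(IntermediateField.adjoin ℚ (Set.range x ∪ Set.range (Complex.exp ∘ x))) < (n : Cardinal) ∧ ∀ r < n, Literature.NumberTheory.Transcendental.SchanuelRank r) → {k : Fin n → ℤ | LinearIndependent ℚ (fun i => x i + 2 * ↑Real.pi * Complex.I * (k i : ℂ)) ∧ ∀ p : MvPolynomial (Fin n ⊕ Fin n) ℚ, MvPolynomial.aeval (Sum.elim x (Complex.exp ∘ x)) p = 0 → MvPolynomial.aeval (Sum.elim (fun i => x i + 2 * ↑Real.pi * Complex.I * (k i : ℂ)) (Complex.exp ∘ fun i => x i + 2 * ↑Real.pi * Complex.I * (k i : ℂ))) p = 0}.Infinite → (IsAlgebraic ↥(IntermediateField.adjoin ℚ (Set.range x ∪ Set.range (Complex.exp ∘ x))) (2 * ↑Real.pi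 * Complex.I) → (∀ (k₀ v : Fin n → ℤ), v ≠ 0 → (LinearIndependent ℚ (fun i => x i + 2 * ↑Real.pi * Complex.I * (k₀ i : ℂ)) ∧ ∀ p : MvPolynomial (Fin n ⊕ Fin n) ℚ, MvPolynomial.aeval (Sum.elim x (Complex.exp ∘ x)) p = 0 → MvPolynomial.aeval (Sum.elim (fun i => x i + 2 * ↑Real.pi * Complex.I * (k₀ i : ℂ)) (Complex.exp ∘ fun i => x i + 2 * ↑Real.pi * Complex.I * (k₀ i : ℂ))) p = 0) → {t : ℤ | ∀ p : MvPolynomial (Fin n ⊕ Fin n) ℚ, MvPolynomial.aeval (Sum.elim x (Complex.exp ∘ x)) p = 0 → MvPolynomial.aeval (Sum.elim (fun i => x i + 2 * ↑Real.pi * Complex.I * ((k₀ + t • v) i : ℂ)) (Complex.exp ∘ fun i => x i + 2 * ↑Real.pi * Complex.I * ((k₀ + t • v) i : ℂ))) p = 0}.Finite) → (∃ (k₀ v : Fin n → ℤ), v ≠ 0 ∧ (LinearIndependent ℚ (fun i => x i + 2 * ↑Real.pi * Complex.I * (k₀ i : ℂ)) ∧ ∀ p : MvPolynomial (Fin n ⊕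 Fin n) ℚ, MvPolynomial.aeval (Sum.elim x (Complex.exp ∘ x)) p = 0 → MvPolynomial.aeval (Sum.elim (fun i => x i + 2 * ↑Real.pi * Complex.I * (k₀ i : ℂ)) (Complex.exp ∘ fun i => x i + 2 * ↑Real.pi * Complex.I * (k₀ i : ℂ))) p = 0) ∧ ∀ s : ℂ, ∀ p : MvPolynomial (Fin n ⊕ Fin n) ℚ, MvPolynomial.aeval (Sum.elim x (Complex.exp ∘ x)) p = 0 → MvPolynomial.aeval (Sum.elim (fun i => x i + 2 * ↑Real.pi * Complex.I * (k₀ i : ℂ) + s * (v i : ℂ)) (Complex.exp ∘ x)) p = 0)) → ∃ (m : ℕ) (q : Fin m → Fin n → ℚ) (k₀ : Fin n → ℤ), m < n ∧ LinearIndependent ℚ q ∧ (LinearIndependent ℚ (fun i => x i + 2 * ↑Real.pi * Complex.I * (k₀ i : ℂ)) ∧ ∀ p : MvPolynomial (Fin n ⊕ Fin n) ℚ, MvPolynomial.aeval (Sum.elim x (Complex.exp ∘ x)) p = 0 → MvPolynomial.aeval (Sum.elim (fun i => x i + 2 * ↑Real.pi * Complex.I * (k₀ i : ℂ)) (Complex.exp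 ∘ fun i => x i + 2 * ↑Real.pi * Complex.I * (k₀ i : ℂ))) p = 0) ∧ ∀ z : Fin n → ℂ, (∀ j, ∑ i, (q j i : ℂ) * z i = ∑ i, (q j i : ℂ) * (x i + 2 * ↑Real.pi * Complex.I * (k₀ i : ℂ))) → ∀ p : MvPolynomial (Fin n ⊕ Fin n) ℚ, MvPolynomial.aeval (Sum.elim x (Complex.exp ∘ x)) p = 0 → MvPolynomial.aeval (Sum.elim z (Complex.exp ∘ x)) p = 0 := by
  intro n _hn x _hx hD hcore
  by_cases hA : Transcendental
      ↥(IntermediateField.adjoin ℚ (Set.range x ∪ Set.range (Complex.exp ∘ x)))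
      (2 * ↑Real.pi * Complex.I)
  · exact concl_of_transcendental x hD hA
  have hB : IsAlgebraic ↥(IntermediateField.adjoin ℚ (Set.range x ∪ Set.range (Complex.exp ∘ x)))
      (2 * ↑Real.pi * Complex.I) := not_not.mp hA
  by_cases hcoll : ∃ (k₀ v : Fin n → ℤ), v ≠ 0 ∧
      (LinearIndependent ℚ (fun i => x i + 2 * ↑Real.pi * Complex.I * (k₀ i : ℂ)) ∧
        ∀ p : MvPolynomial (Fin n ⊕ Fin n) ℚ,
          MvPolynomial.aeval (Sum.elim x (Complex.exp ∘ x)) p = 0 →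
          MvPolynomial.aeval (Sum.elim (fun i => x i + 2 * ↑Real.pi * Complex.I * (k₀ i : ℂ))
            (Complex.exp ∘ fun i => x i + 2 * ↑Real.pi * Complex.I * (k₀ i : ℂ))) p = 0) ∧
      {t : ℤ | ∀ p : MvPolynomial (Fin n ⊕ Fin n) ℚ,
        MvPolynomial.aeval (Sum.elim x (Complex.exp ∘ x)) p = 0 →
        MvPolynomial.aeval
          (Sum.elim (fun i => x i + 2 * ↑Real.pi * Complex.I * ((k₀ + t • v) i : ℂ))
            (Complex.exp ∘ fun i => x i + 2 * ↑Real.pi * Complex.I * ((k₀ + t • v) i : ℂ))) p =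
          0}.Infinite
  · obtain ⟨k₀, v, hv, hk₀, hinf⟩ := hcoll
    exact concl_of_collinear x k₀ v hv hk₀ hinf
  -- the hard case: no rational line through a mate carries infinitely many mates
  obtain ⟨k₀, v, hv, hk₀, hline⟩ :=
    hcore hB fun k₀ v hv hk₀ => Set.not_infinite.mp fun hinf => hcoll ⟨k₀, v, hv, hk₀, hinf⟩
  exact concl_of_line x k₀ v hv hk₀ hline

end Summit.Schanuel.Schanuel.Cruxes.MinimalCounterexampleInAcl.KernelArithmeticSelection
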